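import Literature.MathematicalPhysics.QuantumFieldTheory.Balaban1983to89.B13ChainJointNonvacuityPrefactorsBond

/-!
# `Balaban1983to89.B13ChainJointNonvacuityOddL` — T. Bałaban, *Renormalization group approach to lattice gauge field theories. II. Cluster
expansions*, Commun. Math. Phys. **116** (1988) 1–22, doi:10.1007/bf01239022 [Balaban1988RG2Cluster]:
**THE CONSTANTS FAMILY AT EVERY BLOCK SIZE `L ≥ 8` — the junction of record's constants-level binders (the Lemma-3 numerics at `ℓ = L∕2`, R12, (2.18),
the Lemma-1 ∕ leaf thresholds) at the record's ODD block size, by THREE re-tunings of this seat's `constsQ8A` that leave `ε₂`'s kernel `K₀` fixed**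

statement-level skeleton of published theorems with citation tags; proofs where landed; nothing here is a claim about the
Yang–Mills mass gap

CITATION HEADER (verbatim).  p. 21 [PDF 21], closing paragraph: *"The assumptions allow finally us to fix all the constants, or rather bounds on these
constants."*; [I] = [Balaban1987RG1] p. 253: *"L an odd positive integer"* (the record's block size `θ.ℓ₆ + 1` is ODD); p. 19, the definition of `ε₂`;
p. 20, before (2.37), the restrictions «(L+2)⁴O(1)ε₂ ≦ ½», «2(L+2)⁴O(1)ε₂ exp 5κ ≦ 1»; p. 16, after (2.18): R12.  NOT PRINTED: every explicit number
below — witness data for TYPED hypothesis lists, not Bałaban's constants.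

WHY THIS FILE (cell `pub-ymgap`, node N10 = [B13], seat `pub-ymgap-dag-n10-w3` g4; own-stem successor of `CarriersB13BondTower` §5 (p618083) and
`Summits/…/BalabanUVNodesN10B13BondTowerReduced` (p621116)).  The junction of record's joint inhabitant is, after p621116, ONE ∃-statement over real
letters; its constants-level part is stated at `c13OfRecord θ lam = {lam.c with L := θ.ℓ₆ + 1}` whose `L` is ODD and `≥ 9` (`hL8`) — while EVERY numerics
witness of the chain (lit-balaban `consts`, n10-w1 `constsQ8`, this seat's `constsQ8A`) has `L = 8`.  THIS FILE supplies the family at EVERY `L ≥ 8`: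
`constsOddL L M α₄` = `constsQ8A M α₄` with (i) `L := L`, (ii) `κ₁ := κ₁t + Δ_K(L)`, `Δ_K(L) := 18(1−7δw)(L−8)κw`, so that R20 `18(1−7δ)(L∕2)κ ≤ (κ₁−1)∕2`
holds WITH EQUALITY at every `L` (as lit-balaban's `κ₁t` does at `L = 8`), (iii) `C₂ := 50κ₁t∕κ₁` so that `C₂κ₁ = 50κ₁t` and hence the kernel
`K₀ = 2C₁α₄⁻¹α₆⁻¹M^q e^{C₂κ₁}` of `ε₂` is UNCHANGED (`K₀_constsOddL`), (iv) `ε₁ := ε₁·s(L)`, `s(L) := e^{−Δ_E(L)}·(10∕(L+2))⁴ ≤ 1`,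
`Δ_E(L) := (5∕2)(1−7δw)(L−8)κw`, so that `ε₂` shrinks by `s(L)` and therefore `(L+2)⁴·O(1)·ε₂` and `2(L+2)⁴O(1)ε₂·e^{5(1−7δ)(L∕2)κ}` are EXACTLY their
`L = 8` values (`memberF_constsOddL`, `bracketF_exp_constsOddL`) — p. 20's two restrictions transfer verbatim —, while `C₃·ε₁`, the (2.18) prefactor
and (1.36)'s `E₀ε₁C₁M^q e^{C₂κ₁}` only shrink by `s(L)`.  Then the 25 Lemma-3 numerics (`Lemma3Numerics`) at `ℓ = L∕2` and rate
`aw + 40·log M_b + 20Δ_E(L) + 8(L−8)` follow from this seat's `constsQ8A_numerics_bond` (rate `aw + 40·log M_b`, `ℓ = 4`) conjunct by conjunct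
(monotone in the rate, in `ℓ`, in `κ₁`, or invariant), and the junction's other constants-level binders from `constsQ8A_spec`.

WHAT THIS FILE PROVES (0 `sorry`).  §1 the family (`shiftK`, `shiftE`, `scaleL`, `constsOddL`) and its signs; §2 the four invariance identities
(`K₀_constsOddL`, `eps2_constsOddL`, `memberF_constsOddL` ∕ `bracketF_constsOddL`, `C3act_mul_ε₁_constsOddL`) and the (1.36) ∕ (2.18) prefactor
(`EM_constsOddL`); §3 ★★ `constsOddL_numerics` — `Lemma3Numerics (constsOddL L M α₄) M_b (L∕2) (aw + 40·log M_b + 20Δ_E + 8(L−8)) 1 1 ½ 1` for every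
`L ≥ 8`, `M ≥ κw + 1`, `α₄ > 0`, `M_b ≥ 1`; §4 ★★ `constsOddL_junction` — the junction of record's constants-level binders (`hκ hδ1 hδκ hκ126 hκ126' hκ₁ hκ₁'
hδ₀ hM0 hδ₀M hδ₀M5 hR8 hR9 hC₃ hE hε hC₁ hα hM hτ2` and `R12`) at `constsOddL`, and `constsOddL_with_L` (`{constsOddL L M α₄ with L := L} = constsOddL L M α₄`:
the family IS a constants record OF RECORD shape at `L = θ.ℓ₆ + 1`).

HONEST SCOPE.  Consistency of typed inequality lists at explicit (astronomical) witness constants, for every block size — nothing about the size of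
Bałaban's constants; the `δ := 3∕40` of the family is NOT print's `(1 − 2∕L)∕10` of R22 for `L ≠ 8` (R22 is a binder of the K0∕K2 stubs, not of the N10
junction); the junction's OTHER numerics (the rung at `rf`, NODE A's budget ∕ floor, the located volume dials) are NOT here (they do not read `L`;
`B13ChainJointNonvacuityPrefactors(Bond)` supplies them at `θ₀ := θ₀max`, the volume-located re-dial is the remaining item).  Count-neutral; N10 NOT
discharged; K1⁸ NOT claimed; one finite four-torus programme at fixed ε; nothing continuum ∕ ℝ⁴ ∕ OS ∕ mass-gap ∕ Clay.
-/

noncomputable section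

namespace Literature.MathematicalPhysics.QuantumFieldTheory.Balaban1983to89.B13ChainJointNonvacuityOddL

open Literature.MathematicalPhysics.QuantumFieldTheory.Balaban1983to89
open Literature.MathematicalPhysics.QuantumFieldTheory.Balaban1983to89.B12TreeDecay (kappa₀ K₀ K₀_pos kappa₀_nonneg)
open Literature.MathematicalPhysics.QuantumFieldTheory.Balaban1983to89.B13Bound143 (invTau R12)
open Literature.MathematicalPhysics.QuantumFieldTheory.Balaban1983to89.B13Lemma3WindowNonvacuity (κw aw δw μw)
open Literature.MathematicalPhysics.QuantumFieldTheory.Balaban1983to89.B13Lemma3TorusNonvacuity (κ₁t ε₁t)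
open Literature.MathematicalPhysics.QuantumFieldTheory.Balaban1983to89.B13Lemma3TorusSocket (Lemma3Numerics)
open Literature.MathematicalPhysics.QuantumFieldTheory.Balaban1983to89.B13NodeTorusFamilyNonvacuity (aw_pos)
open Literature.MathematicalPhysics.QuantumFieldTheory.Balaban1983to89.B13ChainJointNonvacuity226 (κw_lower)
open Literature.MathematicalPhysics.QuantumFieldTheory.Balaban1983to89.B13ChainJointNonvacuityPrefactors (constsQ8A constsQ8A_spec constsQ8A_ε₁_pos)
open Literature.MathematicalPhysics.QuantumFieldTheory.Balaban1983to89.B13ChainJointNonvacuityPrefactorsBond (constsQ8A_numerics_bond)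
open Literature.MathematicalPhysics.QuantumFieldTheory.Balaban1983to89.B13Step237 (memberF bracketF R18half R18sharp)

/-! ## §1. The family -/

/-- The `κ₁`-shift `Δ_K(L) := 18(1 − 7δw)(L − 8)κw` making R20 an equality at `ℓ = L∕2`. [cite: Balaban1988RG2Cluster, p.20 (R20, before (2.37)), p.21] -/
def shiftK (L : ℕ) : ℝ := 18 * (1 - 7 * δw) * ((L : ℝ) - 8) * κw

/-- The `ε₂`-shift exponent `Δ_E(L) := (5∕2)(1 − 7δw)(L − 8)κw` absorbing `e^{5(1−7δ)(L∕2 − 4)κ}` of R18sharp. [cite: Balaban1988RG2Cluster, p.20 (before (2.37)), p.21] -/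
def shiftE (L : ℕ) : ℝ := 5 / 2 * (1 - 7 * δw) * ((L : ℝ) - 8) * κw

/-- The `ε₁`-scale `s(L) := e^{−Δ_E(L)}·(10∕(L+2))⁴` (`≤ 1`, `= 1` at `L = 8`). [cite: Balaban1988RG2Cluster, p.19 (ε₂), p.20 (before (2.37)), p.21] -/
def scaleL (L : ℕ) : ℝ := Real.exp (-(shiftE L)) * (10 / ((L : ℝ) + 2)) ^ 4

/-- **THE CONSTANTS FAMILY AT BLOCK SIZE `L`**: `constsQ8A M a` with `L := L`, `κ₁ := κ₁t + Δ_K(L)`, `C₂ := 50κ₁t∕κ₁`, `ε₁ := ε₁·s(L)`.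
[cite: Balaban1988RG2Cluster, p.21 (closing paragraph); Balaban1987RG1, p.253 («L an odd positive integer»)] -/
def constsOddL (L : ℕ) (M a : ℝ) : B13.Consts :=
  { constsQ8A M a with
    L := L
    κ₁ := κ₁t + shiftK L
    C₂ := 50 * κ₁t / (κ₁t + shiftK L)
    ε₁ := (constsQ8A M a).ε₁ * scaleL L }

section Signs

variable {L : ℕ}

/-- `0 < 1 − 7δw` (`δw = 3∕40`). [cite: Balaban1988RG2Cluster, p.21 (closing paragraph), witness-data bookkeeping] -/
theorem one_sub_seven_δw_pos : 0 < 1 - 7 * δw := by unfold δw; norm_num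

/-- `1 ≤ κ₁t` and `0 < κ₁t` (`κ₁t = 1 + 36μw`, `μw = (1−7δw)·4·κw ≥ 0`). [cite: Balaban1988RG2Cluster, p.21 (closing paragraph), witness data] -/
theorem one_le_κ₁t : 1 ≤ κ₁t ∧ 0 < κ₁t := by
  have hκ₁t : κ₁t = 1 + 36 * μw := rfl
  have hμ : μw = (1 - 7 * δw) * 4 * κw := rfl
  have hκw := κw_lower.1
  have hμ0 : 0 ≤ μw := by rw [hμ]; exact mul_nonneg (mul_nonneg one_sub_seven_δw_pos.le (by norm_num)) hκw
  constructor <;> linarith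

/-- `0 ≤ Δ_K(L)` for `L ≥ 8`. [cite: Balaban1988RG2Cluster, p.21 (closing paragraph), witness-data bookkeeping] -/
theorem shiftK_nonneg (hL : 8 ≤ L) : 0 ≤ shiftK L := by
  unfold shiftK
  have h8 : (8 : ℝ) ≤ (L : ℝ) := by exact_mod_cast hL
  have := one_sub_seven_δw_pos
  have := κw_lower.1
  have : 0 ≤ (L : ℝ) - 8 := by linarith
  positivity

/-- `0 ≤ Δ_E(L)` for `L ≥ 8`. [cite: Balaban1988RG2Cluster, p.21 (closing paragraph), witness-data bookkeeping] -/
theorem shiftE_nonneg (hL : 8 ≤ L) : 0 ≤ shiftE L := by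
  unfold shiftE
  have h8 : (8 : ℝ) ≤ (L : ℝ) := by exact_mod_cast hL
  have := one_sub_seven_δw_pos
  have := κw_lower.1
  have : 0 ≤ (L : ℝ) - 8 := by linarith
  positivity

/-- `0 < κ₁' = κ₁t + Δ_K(L)` for `L ≥ 8`. [cite: Balaban1988RG2Cluster, p.21 (closing paragraph), witness-data bookkeeping] -/
theorem κ₁_constsOddL_pos (hL : 8 ≤ L) : 0 < κ₁t + shiftK L := by
  have := one_le_κ₁t.2; have := shiftK_nonneg hL; linarith

/-- `0 < s(L) ≤ 1` for `L ≥ 8`. [cite: Balaban1988RG2Cluster, p.21 (closing paragraph), witness-data bookkeeping] -/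
theorem scaleL_pos_le_one (hL : 8 ≤ L) : 0 < scaleL L ∧ scaleL L ≤ 1 := by
  unfold scaleL
  have h8 : (8 : ℝ) ≤ (L : ℝ) := by exact_mod_cast hL
  have hq : 10 / ((L : ℝ) + 2) ≤ 1 := by rw [div_le_one (by linarith)]; linarith
  have hq0 : 0 < 10 / ((L : ℝ) + 2) := by positivity
  refine ⟨by positivity, ?_⟩
  have h1 : Real.exp (-(shiftE L)) ≤ 1 := by
    rw [Real.exp_le_one_iff]; linarith [shiftE_nonneg hL]
  have h2 : (10 / ((L : ℝ) + 2)) ^ 4 ≤ 1 := pow_le_one₀ hq0.le hq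
  calc Real.exp (-(shiftE L)) * (10 / ((L : ℝ) + 2)) ^ 4 ≤ 1 * 1 :=
        mul_le_mul h1 h2 (by positivity) zero_le_one
    _ = 1 := one_mul 1

/-- `(10∕(L+2))⁴ ≥ e^{−(8(L−8))∕20}` — the polynomial part of `s(L)` against the extra rate `8(L−8)` (`(L+2)∕10 ≤ e^{(L−8)∕10}`).
[cite: Balaban1988RG2Cluster, p.21 (closing paragraph), witness-data bookkeeping] -/
theorem exp_neg_le_tenth_pow (hL : 8 ≤ L) : Real.exp (-((8 * ((L : ℝ) - 8)) / 20)) ≤ (10 / ((L : ℝ) + 2)) ^ 4 := by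
  have h8 : (8 : ℝ) ≤ (L : ℝ) := by exact_mod_cast hL
  set x : ℝ := (L : ℝ) - 8 with hx
  have hx0 : 0 ≤ x := by linarith
  -- `(L+2)/10 = 1 + x/10 ≤ e^{x/10}`
  have hkey : ((L : ℝ) + 2) / 10 ≤ Real.exp (x / 10) := by
    have := Real.add_one_le_exp (x / 10)
    have e : ((L : ℝ) + 2) / 10 = x / 10 + 1 := by rw [hx]; ring
    rw [e]; exact this
  have hpos : 0 < ((L : ℝ) + 2) / 10 := by positivity
  have h4 : (((L : ℝ) + 2) / 10) ^ 4 ≤ Real.exp (x / 10) ^ 4 := pow_le_pow_left₀ hpos.le hkey 4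
  have hexp : Real.exp (x / 10) ^ 4 = Real.exp (4 * (x / 10)) := by rw [← Real.exp_nat_mul]; norm_num
  rw [hexp] at h4
  -- invert
  have hinv : (10 / ((L : ℝ) + 2)) ^ 4 = ((((L : ℝ) + 2) / 10) ^ 4)⁻¹ := by
    rw [← inv_pow, inv_div]
  rw [hinv, show -((8 * x) / 20) = -(4 * (x / 10)) by ring, Real.exp_neg]
  exact inv_anti₀ (by positivity) h4

end Signs

/-! ## §2. The invariance identities -/

section Identities

variable {L : ℕ} {M a : ℝ}

/-- Field bookkeeping (`rfl`). [cite: Balaban1988RG2Cluster, p.21 (closing paragraph)] -/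
theorem constsOddL_fields (L : ℕ) (M a : ℝ) :
    (constsOddL L M a).L = L ∧ (constsOddL L M a).q = 8 ∧ (constsOddL L M a).M = M ∧ (constsOddL L M a).κ = κw ∧
      (constsOddL L M a).κ₁ = κ₁t + shiftK L ∧ (constsOddL L M a).δ = δw ∧ (constsOddL L M a).δ₀ = 1 ∧ (constsOddL L M a).E₀ = 2 ∧
      (constsOddL L M a).ε₁ = (constsQ8A M a).ε₁ * scaleL L ∧ (constsOddL L M a).C₁ = 1 ∧ (constsOddL L M a).C₂ = 50 * κ₁t / (κ₁t + shiftK L) ∧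
      (constsOddL L M a).C₃ = 1 ∧ (constsOddL L M a).α₄ = a ∧ (constsOddL L M a).α₆ = (constsQ8A M a).α₆ ∧ (constsOddL L M a).A₁ = (constsQ8A M a).A₁ :=
  ⟨rfl, rfl, rfl, rfl, rfl, rfl, rfl, rfl, rfl, rfl, rfl, rfl, rfl, rfl, rfl⟩

/-- `{constsOddL L M a with L := L} = constsOddL L M a` — so `c13OfRecord θ lam = constsOddL (θ.ℓ₆+1) M a` when `lam.c = constsOddL (θ.ℓ₆+1) M a`.
[cite: Balaban1988RG2Cluster, p.20 (bookkeeping)] -/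
theorem constsOddL_with_L (L : ℕ) (M a : ℝ) : ({ constsOddL L M a with L := L } : B13.Consts) = constsOddL L M a := rfl

/-- `C₂·κ₁ = 50·κ₁t` on the family (`L ≥ 8`). [cite: Balaban1988RG2Cluster, p.19 (definition of ε₂), witness data] -/
theorem C₂_mul_κ₁_constsOddL (hL : 8 ≤ L) : (constsOddL L M a).C₂ * (constsOddL L M a).κ₁ = 50 * κ₁t := by
  show 50 * κ₁t / (κ₁t + shiftK L) * (κ₁t + shiftK L) = 50 * κ₁t
  exact div_mul_cancel₀ _ (ne_of_gt (κ₁_constsOddL_pos hL))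

/-- ★ **`K₀` IS UNCHANGED**: `K₀(constsOddL L M a) = K₀(constsQ8A M a)` (`2C₁α₄⁻¹α₆⁻¹M^q e^{C₂κ₁}` with `C₂κ₁ = 50κ₁t`).
[cite: Balaban1988RG2Cluster, p.19 (definition of ε₂)] -/
theorem K₀_constsOddL (hL : 8 ≤ L) : (constsOddL L M a).K₀ = (constsQ8A M a).K₀ := by
  unfold B13.Consts.K₀
  rw [C₂_mul_κ₁_constsOddL hL]
  rfl

/-- ★ **`ε₂` SCALES BY `s(L)`**: `eps2 (constsOddL L M a) = eps2 (constsQ8A M a) · s(L)`. [cite: Balaban1988RG2Cluster, p.19 (definition of ε₂)] -/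
theorem eps2_constsOddL (hL : 8 ≤ L) : (constsOddL L M a).eps2 = (constsQ8A M a).eps2 * scaleL L := by
  unfold B13.Consts.eps2
  rw [K₀_constsOddL hL]
  show 2 * ((constsQ8A M a).ε₁ * scaleL L) * (constsQ8A M a).K₀ = 2 * (constsQ8A M a).ε₁ * (constsQ8A M a).K₀ * scaleL L
  ring

/-- ★ **p. 20's «(L+2)⁴O(1)ε₂» IS ITS `L = 8` VALUE TIMES `e^{−Δ_E}`**: `memberF (constsOddL L M a) A = memberF (constsQ8A M a) A · e^{−Δ_E(L)}`
(`(L+2)⁴·(10∕(L+2))⁴ = 10⁴`). [cite: Balaban1988RG2Cluster, p.20 (before (2.37))] -/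
theorem memberF_constsOddL (hL : 8 ≤ L) (A : ℝ) : memberF (constsOddL L M a) A = memberF (constsQ8A M a) A * Real.exp (-(shiftE L)) := by
  unfold memberF
  rw [eps2_constsOddL hL]
  show ((L : ℝ) + 2) ^ 4 * A * ((constsQ8A M a).eps2 * scaleL L)
    = (((8 : ℕ) : ℝ) + 2) ^ 4 * A * (constsQ8A M a).eps2 * Real.exp (-(shiftE L))
  unfold scaleL
  have hL0 : ((L : ℝ) + 2) ≠ 0 := by positivity
  have h10 : ((L : ℝ) + 2) ^ 4 * (10 / ((L : ℝ) + 2)) ^ 4 = (((8 : ℕ) : ℝ) + 2) ^ 4 := by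
    rw [div_pow]; field_simp; norm_num
  calc ((L : ℝ) + 2) ^ 4 * A * ((constsQ8A M a).eps2 * (Real.exp (-(shiftE L)) * (10 / ((L : ℝ) + 2)) ^ 4))
      = (((L : ℝ) + 2) ^ 4 * (10 / ((L : ℝ) + 2)) ^ 4) * A * (constsQ8A M a).eps2 * Real.exp (-(shiftE L)) := by ring
    _ = (((8 : ℕ) : ℝ) + 2) ^ 4 * A * (constsQ8A M a).eps2 * Real.exp (-(shiftE L)) := by rw [h10]

/-- `bracketF` scales the same way. [cite: Balaban1988RG2Cluster, (2.37) p.20] -/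
theorem bracketF_constsOddL (hL : 8 ≤ L) (A : ℝ) : bracketF (constsOddL L M a) A = bracketF (constsQ8A M a) A * Real.exp (-(shiftE L)) := by
  unfold bracketF
  rw [memberF_constsOddL hL]
  ring

/-- ★ **R18sharp's left side at `ℓ = L∕2` IS ITS `L = 8`, `ℓ = 4` VALUE**: `bracketF' A · e^{5(1−7δ)(L∕2)κ} = bracketF A · e^{5(1−7δ)·4·κ}` (`Δ_E` is exactly
the exponent's increment). [cite: Balaban1988RG2Cluster, p.20 (before (2.37))] -/
theorem bracketF_exp_constsOddL (hL : 8 ≤ L) (A : ℝ) :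
    bracketF (constsOddL L M a) A * Real.exp (5 * ((1 - 7 * (constsOddL L M a).δ) * ((L : ℝ) / 2) * (constsOddL L M a).κ))
      = bracketF (constsQ8A M a) A * Real.exp (5 * ((1 - 7 * (constsQ8A M a).δ) * ((((8 : ℕ) : ℝ)) / 2) * (constsQ8A M a).κ)) := by
  rw [bracketF_constsOddL hL, mul_assoc, ← Real.exp_add]
  congr 1
  show Real.exp (-(shiftE L) + 5 * ((1 - 7 * δw) * ((L : ℝ) / 2) * κw)) = Real.exp (5 * ((1 - 7 * δw) * ((((8 : ℕ) : ℝ)) / 2) * κw))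
  congr 1
  unfold shiftE
  push_cast
  ring

/-- ★ **`C₃·ε₁` SCALES BY `e^{−Δ_E}`**: `C3act' · ε₁' = C3act · ε₁ · e^{−Δ_E(L)}` (the `(L+2)⁴` of `C₃` against the `(10∕(L+2))⁴` of `s(L)`).
[cite: Balaban1988RG2Cluster, p.20 (definition of C₃)] -/
theorem C3act_mul_ε₁_constsOddL (hL : 8 ≤ L) :
    (constsOddL L M a).C3act * (constsOddL L M a).ε₁ = (constsQ8A M a).C3act * (constsQ8A M a).ε₁ * Real.exp (-(shiftE L)) := by
  unfold B13.Consts.C3act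
  rw [K₀_constsOddL hL]
  show 2 * ((L : ℝ) + 2) ^ 4 * (constsQ8A M a).A₁ * (2 * (constsQ8A M a).K₀) * ((constsQ8A M a).ε₁ * scaleL L)
    = 2 * (((8 : ℕ) : ℝ) + 2) ^ 4 * (constsQ8A M a).A₁ * (2 * (constsQ8A M a).K₀) * (constsQ8A M a).ε₁ * Real.exp (-(shiftE L))
  unfold scaleL
  have hL0 : ((L : ℝ) + 2) ≠ 0 := by positivity
  have h10 : ((L : ℝ) + 2) ^ 4 * (10 / ((L : ℝ) + 2)) ^ 4 = (((8 : ℕ) : ℝ) + 2) ^ 4 := by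
    rw [div_pow]; field_simp; norm_num
  calc 2 * ((L : ℝ) + 2) ^ 4 * (constsQ8A M a).A₁ * (2 * (constsQ8A M a).K₀) * ((constsQ8A M a).ε₁ * (Real.exp (-(shiftE L)) * (10 / ((L : ℝ) + 2)) ^ 4))
      = 2 * (((L : ℝ) + 2) ^ 4 * (10 / ((L : ℝ) + 2)) ^ 4) * (constsQ8A M a).A₁ * (2 * (constsQ8A M a).K₀) * (constsQ8A M a).ε₁ *
          Real.exp (-(shiftE L)) := by ring
    _ = 2 * (((8 : ℕ) : ℝ) + 2) ^ 4 * (constsQ8A M a).A₁ * (2 * (constsQ8A M a).K₀) * (constsQ8A M a).ε₁ * Real.exp (-(shiftE L)) := by rw [h10]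

/-- ★ **THE (1.36) ∕ (2.18) PREFACTOR SCALES BY `s(L)`**: `E₀ε₁'C₁M^q e^{C₂'κ₁'} = E₀ε₁C₁M^q e^{C₂κ₁} · s(L)`. [cite: Balaban1988RG2Cluster, (1.36) p.9, (2.18) p.16] -/
theorem EM_constsOddL (hL : 8 ≤ L) :
    (constsOddL L M a).E₀ * (constsOddL L M a).ε₁ * (constsOddL L M a).C₁ * (constsOddL L M a).M ^ (constsOddL L M a).q *
        Real.exp ((constsOddL L M a).C₂ * (constsOddL L M a).κ₁)
      = (constsQ8A M a).E₀ * (constsQ8A M a).ε₁ * (constsQ8A M a).C₁ * (constsQ8A M a).M ^ (constsQ8A M a).q *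
        Real.exp ((constsQ8A M a).C₂ * (constsQ8A M a).κ₁) * scaleL L := by
  rw [C₂_mul_κ₁_constsOddL hL]
  show 2 * ((constsQ8A M a).ε₁ * scaleL L) * 1 * M ^ 8 * Real.exp (50 * κ₁t) = 2 * (constsQ8A M a).ε₁ * 1 * M ^ 8 * Real.exp (50 * κ₁t) * scaleL L
  ring

end Identities


/-! ## §3. The Lemma-3 numerics at every block size -/

section Numerics

variable {L : ℕ} {M a : ℝ}

/-- The O(1) of (2.37) is antitone in the rate (re-derived; n10-w3 g3's copy is private; same statement as the other summit tree's
`TwoRunTorusNE5Uniform.A237_antitone`, not importable here). [cite: Balaban1988RG2Cluster, (2.37) p.20] -/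
private theorem argX_antitone {r r' : ℝ} (h : r ≤ r') :
    K₀ 64 8 * Real.exp (Real.exp (-(r' / 20)) * 64) ≤ K₀ 64 8 * Real.exp (Real.exp (-(r / 20)) * 64) := by
  have hK₀ : 0 < K₀ 64 8 := K₀_pos 64 8
  refine mul_le_mul_of_nonneg_left (Real.exp_le_exp.2 ?_) hK₀.le
  exact mul_le_mul_of_nonneg_right (Real.exp_le_exp.2 (by linarith)) (by norm_num)

/-- `memberF` is monotone in its O(1) argument when `ε₂ ≥ 0`. [cite: Balaban1988RG2Cluster, (2.37) p.20] -/
theorem memberF_mono {c : B13.Consts} (hε : 0 ≤ c.eps2) {A A' : ℝ} (h : A' ≤ A) : memberF c A' ≤ memberF c A := by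
  unfold memberF
  exact mul_le_mul_of_nonneg_right (mul_le_mul_of_nonneg_left h (by positivity)) hε

/-- ★★ **THE 25 LEMMA-3 NUMERICS AT EVERY BLOCK SIZE `L ≥ 8`**, `ℓ = L∕2`, bond fineness `M_b ≥ 1`, rate `aw + 40·log M_b + 20Δ_E(L) + 8(L−8)`,
`a₂ = a₂′ = 1`, `a₅ = ½`, `A_abs = 1` — conjunct by conjunct from `constsQ8A_numerics_bond` (rate `aw + 40·log M_b`, `ℓ = 4`): invariant (`hα₆ hδ hδ7 hκ
hκ229 hsm229 hsm229'`), monotone in the rate (`ha hR16 hR16' h231 habsk`), in `ℓ` (`hκ229' hAc`), in `κ₁` (`habs`), by the identities of §2 (`hε₀ hR15 hR17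
h18half h18 hC3`), and R20 WITH EQUALITY. [cite: Balaban1988RG2Cluster, pp.17–20 (restrictions on the constants), Lemma 3 p.20, p.21 (closing paragraph)] -/
theorem constsOddL_numerics (hL : 8 ≤ L) (hM : κw + 1 ≤ M) (ha : 0 < a) (Mb : ℕ) (hMb : 1 ≤ Mb) :
    Lemma3Numerics (constsOddL L M a) Mb ((L : ℝ) / 2)
      (aw + 40 * Real.log Mb + 20 * shiftE L + 8 * ((L : ℝ) - 8)) 1 1 (1 / 2) 1 := by
  have N := constsQ8A_numerics_bond hM ha Mb hMb
  obtain ⟨hs0, hs1⟩ := scaleL_pos_le_one hL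
  have hΔE := shiftE_nonneg hL
  have hΔK := shiftK_nonneg hL
  have h8 : (8 : ℝ) ≤ (L : ℝ) := by exact_mod_cast hL
  have hℓ4 : ((((8 : ℕ) : ℝ)) / 2) ≤ (L : ℝ) / 2 := by push_cast; linarith
  -- the two rates
  set r : ℝ := aw + 40 * Real.log Mb with hr
  set r' : ℝ := aw + 40 * Real.log Mb + 20 * shiftE L + 8 * ((L : ℝ) - 8) with hr'
  have hrr : r ≤ r' := by rw [hr, hr']; nlinarith
  have hA := argX_antitone hrr
  -- signs of the base record
  have hε₀ : 0 ≤ (constsQ8A M a).eps2 := N.hε₀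
  have hδ0 : 0 ≤ (constsQ8A M a).δ := N.hδ
  have hκ0 : 0 ≤ (constsQ8A M a).κ := N.hκ
  have hα₆ : 0 < (constsQ8A M a).α₆ := N.hα₆
  -- the new ε₂ is the old times `s(L) ≤ 1`
  have heps : (constsOddL L M a).eps2 = (constsQ8A M a).eps2 * scaleL L := eps2_constsOddL hL
  have heps_le : (constsOddL L M a).eps2 ≤ (constsQ8A M a).eps2 := by
    rw [heps]; exact mul_le_of_le_one_right hε₀ hs1
  have heps0 : 0 ≤ (constsOddL L M a).eps2 := by rw [heps]; exact mul_nonneg hε₀ hs0.le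
  -- the rate exponentials
  have hexp20 : Real.exp (-(r' / 20)) ≤ Real.exp (-(r / 20)) := Real.exp_le_exp.2 (by linarith)
  have hexp10 : Real.exp (-(r' / 10)) ≤ Real.exp (-(r / 10)) := Real.exp_le_exp.2 (by linarith)
  refine ⟨by positivity, N.hα₆, heps0, N.hδ, N.hδ7, N.hκ, ?_, ?_, ?_, ?_, ?_, ?_, N.ha₂, N.hκ229, N.hsm229, ?_, ?_, ?_, N.ha₂', ?_, N.hsm229', ?_, N.ha₅, ?_, ?_, ?_⟩
  · -- ha
    have := N.ha; linarith
  · -- hR15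
    show (constsOddL L M a).eps2 * Real.exp (5 * (constsOddL L M a).κ) ≤ 1
    have h15 : (constsQ8A M a).eps2 * Real.exp (5 * (constsQ8A M a).κ) ≤ 1 := N.hR15
    exact (mul_le_mul_of_nonneg_right heps_le (Real.exp_pos _).le).trans h15
  · -- hR16
    have := N.hR16; show 18 * ((1 - 4 * (constsQ8A M a).δ) * (constsQ8A M a).κ) ≤ r' / 20; linarith
  · -- hR16'
    have := N.hR16'; show 4 * (constsQ8A M a).κ ≤ r' / 20; linarith
  · -- hR17
    have h17 : Real.exp (-(r / 20)) ≤ (constsQ8A M a).eps2 := N.hR17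
    rw [heps]
    have hsplit : Real.exp (-(r' / 20)) = Real.exp (-(r / 20)) * (Real.exp (-(shiftE L)) * Real.exp (-((8 * ((L : ℝ) - 8)) / 20))) := by
      rw [← Real.exp_add, ← Real.exp_add]; congr 1; rw [hr, hr']; ring
    rw [hsplit]
    refine mul_le_mul h17 ?_ (by positivity) hε₀
    unfold scaleL
    exact mul_le_mul_of_nonneg_left (exp_neg_le_tenth_pow hL) (Real.exp_pos _).le
  · -- h231
    have h := N.h231
    have hMb4 : 0 ≤ 2 * (4 : ℝ) * (Mb : ℝ) ^ 4 := by positivity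
    calc 2 * (4 : ℝ) * (Mb : ℝ) ^ 4 * Real.exp (-(r' / 10)) ≤ 2 * (4 : ℝ) * (Mb : ℝ) ^ 4 * Real.exp (-(r / 10)) :=
          mul_le_mul_of_nonneg_left hexp10 hMb4
      _ ≤ r / 20 := h
      _ ≤ r' / 20 := by linarith
  · -- habsk
    have h := N.habsk
    show Real.exp (-(r' / 20)) * 64 ≤ (constsQ8A M a).δ * (constsQ8A M a).κ
    nlinarith [hexp20, Real.exp_pos (-(r' / 20))]
  · -- h18half
    show memberF (constsOddL L M a) (K₀ 64 8 * Real.exp (Real.exp (-(r' / 20)) * 64)) ≤ 1 / 2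
    have h := N.h18half
    unfold R18half at h
    rw [memberF_constsOddL hL]
    have hm0 : 0 ≤ memberF (constsQ8A M a) (K₀ 64 8 * Real.exp (Real.exp (-(r' / 20)) * 64)) := by
      unfold memberF; have := K₀_pos 64 8; positivity
    have hexp1 : Real.exp (-(shiftE L)) ≤ 1 := by rw [Real.exp_le_one_iff]; linarith
    calc memberF (constsQ8A M a) (K₀ 64 8 * Real.exp (Real.exp (-(r' / 20)) * 64)) * Real.exp (-(shiftE L))
        ≤ memberF (constsQ8A M a) (K₀ 64 8 * Real.exp (Real.exp (-(r' / 20)) * 64)) := mul_le_of_le_one_right hm0 hexp1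
      _ ≤ memberF (constsQ8A M a) (K₀ 64 8 * Real.exp (Real.exp (-(r / 20)) * 64)) := memberF_mono hε₀ hA
      _ ≤ 1 / 2 := h
  · -- h18 (R18sharp at ℓ = L/2 IS the old R18sharp at ℓ = 4, up to the O(1)'s monotonicity)
    show bracketF (constsOddL L M a) (K₀ 64 8 * Real.exp (Real.exp (-(r' / 20)) * 64)) *
        Real.exp (5 * ((1 - 7 * (constsOddL L M a).δ) * ((L : ℝ) / 2) * (constsOddL L M a).κ)) ≤ (constsOddL L M a).α₆
    rw [bracketF_exp_constsOddL hL]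
    have h := N.h18
    unfold R18sharp at h
    have hb : bracketF (constsQ8A M a) (K₀ 64 8 * Real.exp (Real.exp (-(r' / 20)) * 64)) ≤
        bracketF (constsQ8A M a) (K₀ 64 8 * Real.exp (Real.exp (-(r / 20)) * 64)) := by
      unfold bracketF; linarith [memberF_mono hε₀ hA]
    exact (mul_le_mul_of_nonneg_right hb (Real.exp_pos _).le).trans h
  · -- hκ229' (monotone in ℓ)
    have h := N.hκ229'
    show kappa₀ 64 8 + 1 ≤ (constsQ8A M a).δ * ((L : ℝ) / 2) * (constsQ8A M a).κ
    have hmono : (constsQ8A M a).δ * ((((8 : ℕ) : ℝ)) / 2) * (constsQ8A M a).κ ≤ (constsQ8A M a).δ * ((L : ℝ) / 2) * (constsQ8A M a).κ :=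
      mul_le_mul_of_nonneg_right (mul_le_mul_of_nonneg_left hℓ4 hδ0) hκ0
    exact h.trans hmono
  · -- hR20 WITH EQUALITY
    show 18 * ((1 - 7 * δw) * ((L : ℝ) / 2) * κw) ≤ (κ₁t + shiftK L - 1) / 2
    have hκ₁t : κ₁t = 1 + 36 * ((1 - 7 * δw) * 4 * κw) := rfl
    rw [hκ₁t]; unfold shiftK
    exact le_of_eq (by ring)
  · -- habs (monotone in κ₁)
    have h := N.habs
    show 1 / 2 + Real.exp (-((κ₁t + shiftK L - 1) / 2)) ≤ 1
    have h' : 1 / 2 + Real.exp (-((κ₁t - 1) / 2)) ≤ 1 := h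
    have hmono : Real.exp (-((κ₁t + shiftK L - 1) / 2)) ≤ Real.exp (-((κ₁t - 1) / 2)) := Real.exp_le_exp.2 (by linarith)
    linarith
  · -- hAc (monotone in ℓ)
    have h := N.hAc
    show 1 * 64 ≤ (constsQ8A M a).δ * ((L : ℝ) / 2) * (constsQ8A M a).κ
    have hmono : (constsQ8A M a).δ * ((((8 : ℕ) : ℝ)) / 2) * (constsQ8A M a).κ ≤ (constsQ8A M a).δ * ((L : ℝ) / 2) * (constsQ8A M a).κ :=
      mul_le_mul_of_nonneg_right (mul_le_mul_of_nonneg_left hℓ4 hδ0) hκ0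
    exact h.trans hmono
  · -- hC3 (both sides scale by e^{−Δ_E}; the O(1) is monotone)
    show bracketF (constsOddL L M a) (K₀ 64 8 * Real.exp (Real.exp (-(r' / 20)) * 64)) / (constsOddL L M a).α₆ * Real.exp (1 * 64)
        ≤ (constsOddL L M a).C3act * (constsOddL L M a).ε₁
    rw [bracketF_constsOddL hL, C3act_mul_ε₁_constsOddL hL]
    have h := N.hC3
    have hb : bracketF (constsQ8A M a) (K₀ 64 8 * Real.exp (Real.exp (-(r' / 20)) * 64)) ≤
        bracketF (constsQ8A M a) (K₀ 64 8 * Real.exp (Real.exp (-(r / 20)) * 64)) := by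
      unfold bracketF; linarith [memberF_mono hε₀ hA]
    have hα : 0 < (constsOddL L M a).α₆ := hα₆
    have hkey : bracketF (constsQ8A M a) (K₀ 64 8 * Real.exp (Real.exp (-(r' / 20)) * 64)) / (constsQ8A M a).α₆ * Real.exp (1 * 64)
        ≤ (constsQ8A M a).C3act * (constsQ8A M a).ε₁ :=
      le_trans (mul_le_mul_of_nonneg_right (div_le_div_of_nonneg_right hb hα₆.le) (Real.exp_pos _).le) h
    have hE : 0 ≤ Real.exp (-(shiftE L)) := (Real.exp_pos _).le
    calc bracketF (constsQ8A M a) (K₀ 64 8 * Real.exp (Real.exp (-(r' / 20)) * 64)) * Real.exp (-(shiftE L)) / (constsOddL L M a).α₆ * Real.exp (1 * 64)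
        = (bracketF (constsQ8A M a) (K₀ 64 8 * Real.exp (Real.exp (-(r' / 20)) * 64)) / (constsQ8A M a).α₆ * Real.exp (1 * 64)) * Real.exp (-(shiftE L)) := by
          show _ / (constsQ8A M a).α₆ * _ = _; ring
      _ ≤ (constsQ8A M a).C3act * (constsQ8A M a).ε₁ * Real.exp (-(shiftE L)) := mul_le_mul_of_nonneg_right hkey hE

end Numerics

/-! ## §4. The junction of record's other constants-level binders at every block size -/

section Junction

variable {L : ℕ} {M a : ℝ}

/-- ★★ **THE JUNCTION's CONSTANTS-LEVEL BINDERS AT `constsOddL L M α₄`** (`L ≥ 8`, `M ≥ κw + 1` AND `M⁴ ≥` the (2.26) floor asked, `α₄ > 0`): the Lemma-1 ∕ leaf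
thresholds `hκ hδ1 hδκ hκ126 hκ126' hκ₁ hκ₁' hδ₀ hM0 hδ₀M hδ₀M5 hR8 hR9`, `0 ≤ C₃`, the signs `hE hε hC₁ hα hM`, (2.18)'s `hτ2` and R12 — every `κ₁`-clause by
monotonicity (`κ₁ ≥ κ₁t`), `hτ2` by `EM_constsOddL` (the prefactor only shrinks), the rest field-identical to `constsQ8A_spec`.
[cite: Balaban1988RG2Cluster, p.16 (after (2.18)), (2.18) p.16, p.21 (closing paragraph)] -/
theorem constsOddL_junction (hL : 8 ≤ L) (hM : κw + 1 ≤ M) (ha : 0 < a) :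
    0 ≤ (constsOddL L M a).κ ∧ (constsOddL L M a).δ < 1 ∧ 1 ≤ (constsOddL L M a).δ * (constsOddL L M a).κ ∧
      kappa₀ 64 8 ≤ (constsOddL L M a).κ ∧ kappa₀ 64 8 ≤ (constsOddL L M a).δ * (constsOddL L M a).κ ∧
      1 + 2 * Real.log (8 * 12 ^ 3) ≤ (constsOddL L M a).κ₁ ∧ 2 + 16 * Real.log 128 ≤ (constsOddL L M a).κ₁ ∧
      0 ≤ (constsOddL L M a).δ₀ ∧ 0 ≤ (constsOddL L M a).M ∧
      10 * Real.exp (-1) ≤ (constsOddL L M a).δ₀ * (constsOddL L M a).M ∧ 2 * Real.log 5 ≤ (constsOddL L M a).δ₀ * (constsOddL L M a).M ∧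
      (1 - (constsOddL L M a).δ) * (constsOddL L M a).κ ≤ (1 / 4) * ((constsOddL L M a).κ₁ - 1) ∧
      (1 - 2 * (constsOddL L M a).δ) * (constsOddL L M a).κ ≤ (1 / 16) * (constsOddL L M a).κ₁ ∧
      0 ≤ (constsOddL L M a).C₃ ∧ 0 < (constsOddL L M a).E₀ ∧ 0 < (constsOddL L M a).ε₁ ∧ 0 < (constsOddL L M a).C₁ ∧
      0 < (constsOddL L M a).α₄ ∧ 1 ≤ (constsOddL L M a).M ∧
      (constsOddL L M a).E₀ * (constsOddL L M a).ε₁ * (constsOddL L M a).C₁ * (constsOddL L M a).α₄⁻¹ * (constsOddL L M a).M ^ (constsOddL L M a).q *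
          Real.exp ((constsOddL L M a).C₂ * (constsOddL L M a).κ₁) ≤ 1 / 2 ∧
      R12 (constsOddL L M a) := by
  obtain ⟨⟨hq, h12, -, -, -, hM1, hE, hε, hC₁, hα, hC₃, -⟩, ⟨-, -, hκ126, hκ126', hκ, hδ1, hδκ, hκ₁, hκ₁', hδ₀M, hδ₀M5, hR8, hR9, -, -, -⟩, -⟩ :=
    constsQ8A_spec hM ha
  obtain ⟨hs0, hs1⟩ := scaleL_pos_le_one hL
  have hΔK := shiftK_nonneg hL
  have hκ₁le : κ₁t ≤ κ₁t + shiftK L := by linarith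
  have hτ : (constsQ8A M a).E₀ * (constsQ8A M a).ε₁ * (constsQ8A M a).C₁ * (constsQ8A M a).α₄⁻¹ * (constsQ8A M a).M ^ (constsQ8A M a).q *
      Real.exp ((constsQ8A M a).C₂ * (constsQ8A M a).κ₁) ≤ 1 / 2 :=
    B13ChainJointNonvacuityPrefactors.constsQ8A_invTau_zero hM ha
  refine ⟨hκ, hδ1, hδκ, hκ126, hκ126', ?_, ?_, by show (0:ℝ) ≤ 1; norm_num, by show (0:ℝ) ≤ M; linarith [κw_lower.1], hδ₀M, hδ₀M5, ?_, ?_,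
    hC₃, hE, mul_pos hε hs0, hC₁, hα, hM1, ?_, ?_⟩
  · show 1 + 2 * Real.log (8 * 12 ^ 3) ≤ κ₁t + shiftK L
    have h' : 1 + 2 * Real.log (8 * 12 ^ 3) ≤ κ₁t := hκ₁
    linarith
  · show 2 + 16 * Real.log 128 ≤ κ₁t + shiftK L
    have h' : 2 + 16 * Real.log 128 ≤ κ₁t := hκ₁'
    linarith
  · show (1 - δw) * κw ≤ (1 / 4) * (κ₁t + shiftK L - 1)
    have h' : (1 - δw) * κw ≤ (1 / 4) * (κ₁t - 1) := hR8
    linarith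
  · show (1 - 2 * δw) * κw ≤ (1 / 16) * (κ₁t + shiftK L)
    have h' : (1 - 2 * δw) * κw ≤ (1 / 16) * κ₁t := hR9
    linarith
  · -- hτ2: the prefactor shrinks by `s(L) ≤ 1`
    have hEM := EM_constsOddL (M := M) (a := a) hL
    have hα4 : (constsOddL L M a).α₄⁻¹ = (constsQ8A M a).α₄⁻¹ := rfl
    have hpos : 0 ≤ (constsQ8A M a).E₀ * (constsQ8A M a).ε₁ * (constsQ8A M a).C₁ * (constsQ8A M a).M ^ (constsQ8A M a).q *
        Real.exp ((constsQ8A M a).C₂ * (constsQ8A M a).κ₁) := by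
      have hMq : 0 < (constsQ8A M a).M ^ (constsQ8A M a).q := pow_pos (by show (0:ℝ) < M; linarith [κw_lower.1]) _
      have := hE; have := hε; have := hC₁
      positivity
    have hαinv : 0 ≤ (constsQ8A M a).α₄⁻¹ := inv_nonneg.2 hα.le
    calc (constsOddL L M a).E₀ * (constsOddL L M a).ε₁ * (constsOddL L M a).C₁ * (constsOddL L M a).α₄⁻¹ *
          (constsOddL L M a).M ^ (constsOddL L M a).q * Real.exp ((constsOddL L M a).C₂ * (constsOddL L M a).κ₁)
        = ((constsOddL L M a).E₀ * (constsOddL L M a).ε₁ * (constsOddL L M a).C₁ * (constsOddL L M a).M ^ (constsOddL L M a).q *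
            Real.exp ((constsOddL L M a).C₂ * (constsOddL L M a).κ₁)) * (constsOddL L M a).α₄⁻¹ := by ring
      _ = ((constsQ8A M a).E₀ * (constsQ8A M a).ε₁ * (constsQ8A M a).C₁ * (constsQ8A M a).M ^ (constsQ8A M a).q *
            Real.exp ((constsQ8A M a).C₂ * (constsQ8A M a).κ₁) * scaleL L) * (constsQ8A M a).α₄⁻¹ := by rw [hEM, hα4]
      _ ≤ ((constsQ8A M a).E₀ * (constsQ8A M a).ε₁ * (constsQ8A M a).C₁ * (constsQ8A M a).M ^ (constsQ8A M a).q *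
            Real.exp ((constsQ8A M a).C₂ * (constsQ8A M a).κ₁) * 1) * (constsQ8A M a).α₄⁻¹ :=
          mul_le_mul_of_nonneg_right (mul_le_mul_of_nonneg_left hs1 hpos) hαinv
      _ = (constsQ8A M a).E₀ * (constsQ8A M a).ε₁ * (constsQ8A M a).C₁ * (constsQ8A M a).α₄⁻¹ * (constsQ8A M a).M ^ (constsQ8A M a).q *
            Real.exp ((constsQ8A M a).C₂ * (constsQ8A M a).κ₁) := by ring
      _ ≤ 1 / 2 := hτ
  · -- R12: the rate clause is monotone in κ₁, the other two are field-identical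
    obtain ⟨h1, h2, h3⟩ := h12
    refine ⟨?_, h2, h3⟩
    show (1 - 3 * δw) * κw ≤ (κ₁t + shiftK L - 1) / 8
    have h' : (1 - 3 * δw) * κw ≤ (κ₁t - 1) / 8 := h1
    linarith

end Junction

end Literature.MathematicalPhysics.QuantumFieldTheory.Balaban1983to89.B13ChainJointNonvacuityOddL

end
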